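import Summits.QuantumFields.BalabanUV.T4Continuum.Support.NE9Lemma1RemainderSpecies
import Summits.QuantumFields.BalabanUV.T4Continuum.Support.NE9MarginalProjectionEnd

/-!
# NE9Lemma1RemainderSpeciesEnd — the NE9 frame's END (marginal-projection face `…_compProj`) AT THE DISPLAYED SPECIES: the
# channel binders S3-sum / S5 DISCHARGED BY NAME from `NE9Lemma1PieceClass` + `NE9Lemma1RemainderSpecies`, S3-additivity from
# the displayed `PieceAdditiveOn` (crew row (w16)), everything else displayed as in the face
# (cell `pub-balaban`, T4-DAG §2 node U3 / §6 NE9; lineage t4-ne9-p1 = row NE9 OWNER, generation 24; part 3)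

HONEST FRAMING (T4-DAG PAGE 1).  Rung (B)+1 of the FINITE-VOLUME T⁴ programme — NOT infinite volume, NOT a mass gap, NOT the
Clay problem.  NE9 (`T4OutputRate.NE9` ∧ `FadingMemory`) is a cell NEW ESTIMATE, NOT PRINTED, NOT discharged here; spine 0/9.
HONEST DEPENDENCY (cell line, verbatim): continuum YM on T⁴ ⇐ BetaPertH ∧ nine spine estimates (0/9 proved); BetaPertH ⇐ (D1)
∧ (D4) ∧ CAP+tail; G-an2-4 gates asym, D1 and NE2/3/4.  `FlowStep.BetaPertH`, (B), (B^μ) do not occur.  [I] = [Balaban1987RG1]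
(CMP **109**), [II] = [Balaban1988RG2Cluster] (CMP **116**) are quoted for TYPES only (ABSOLUTE RULE: nothing printed in the
audited series is asserted).

WHAT THIS FILE IS.  The skeleton's END on the corrected dictionary `T := 𝒯 ∘ P` (`NE9MarginalProjectionEnd.
ne9_and_fadingMemory_of_couplingTwoPoint_vacSub_sizeInduction_compProj`, v1.3 C5) displays three channel binders ON THE
MARGINAL-FREE CLASS `MF`: `ChannelAdditive MF 𝒯`, `ChannelStepSum MF 𝒯`, `ChannelSizeAtStepNN MF 𝒯 κ wt τ` (+ the profile
`hτ`).  For `𝒯 := cpieceChannel D.toC` — the DISPLAYED species of [II] §1 on the analytic class (parts 1–2) — and ANY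
marginal-free class `MF ⊆ analyticClass D.R`:
* §1 monotonicity in the class (`channelSizeAtStepNN_mono`, `pieceAdditiveOn_mono`) — the S-binders are antitone in `Adm`;
* §2 **`termSize_ne9_and_fadingMemory_rem_compProj`**: the face with `hsum` := `channelStepSum_cpiece`, `hstep` :=
  `channelSizeAtStepNN_rem` (PROVED per-piece bound on the analytic class, restricted to MF), `hτ` := `NE9Lemma1Gain.profileG`
  (τ k j = c_Q·ω^{k−j}, τ̄ = c_Q), and `hadd` from the DISPLAYED `PieceAdditiveOn (analyticClass D.R) D.toC` (linearity of
  (1.23) in the old term — crew row (w16), `NE9RemainderPieceAdditive`); conclusion LITERALLY `TermSize E W κ N ∧ NE9 E W κ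
  (prodModuli ℓ₉ (fun _ => ω′)) ∧ FadingMemory (ℓ₉/ω′) ω′ (…)` with `ω′ = ω + 8·lipbar·B·((1 + c)·c_Q)`.
So on this face the displayed list for the species is: O1-type data (`RemData`, the carriers, `P`, `Ψ`, `act`, `ρ`, …), the
binder structure `RemData.Admissible` (domain inclusion (I.3.36)–(3.53), radii, G1 — printed TYPE), the level counts
`LevelCountsG` ((1.26)–(1.28), numerals), `PieceAdditiveOn` ((w16)), `MF ⊆ analyticClass`, and the face's own A1/A2/A3/RO-type
binders and scalars — NO channel-size or step-sum binder remains.  DISGUISE TEST: unchanged from the face (skeleton §5 (g2)); the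
new inputs are one-run, one-history statements about ONE input family.

References (TYPES only): [Balaban1988RG2Cluster] T. Bałaban, CMP **116** (1988) 1–22, (1.23)–(1.29) pp. 7–8, (1.33)–(1.36)
p. 9; [Balaban1987RG1] T. Bałaban, CMP **109** (1987) 249–301, (0.28)–(0.29) p. 258, (3.36) p. 277, (3.54) p. 280.  Summits-side
NEW work (LEAN PLACEMENT RULE); imports parts 1–2 and `NE9MarginalProjectionEnd` BY NAME; modifies nothing; 0 sorry.  Value =
bookkeeping: the species' S-binders removed from the END's displayed list, NOT summit progress.
-/

noncomputable section

namespace Summit.QuantumFields.BalabanUV.T4Continuum.NE9Lemma1RemainderSpeciesEnd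

open scoped BigOperators
open Literature.Probability.LatticeModels
open Literature.MathematicalPhysics.QuantumFieldTheory.Balaban1983to89
open Literature.MathematicalPhysics.QuantumFieldTheory.Balaban1983to89.T4OutputRate
open Literature.MathematicalPhysics.QuantumFieldTheory.Balaban1983to89.T4HistoryLipschitzRecursion
open Literature.MathematicalPhysics.QuantumFieldTheory.Balaban1983to89.T4HistoryLipschitzOuter
open Literature.MathematicalPhysics.QuantumFieldTheory.Balaban1983to89.T4HistoryLipschitzActivity
open Literature.MathematicalPhysics.QuantumFieldTheory.Balaban1983to89.T4HistoryLipschitzActivity (ClusterGeom)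
open Literature.MathematicalPhysics.QuantumFieldTheory.Balaban1983to89.T4HistoryLipschitzSegment
open Summit.QuantumFields.BalabanUV.T4Continuum.NE9Lemma1Counting
open Summit.QuantumFields.BalabanUV.T4Continuum.NE9Lemma1Gain
open Summit.QuantumFields.BalabanUV.T4Continuum.NE9Lemma1PieceClass
open Summit.QuantumFields.BalabanUV.T4Continuum.NE9Lemma1RemainderSpecies
open Summit.QuantumFields.BalabanUV.T4Continuum.NE9ComplexEncoding (doubleCarriers)
open Summit.QuantumFields.BalabanUV.T4Continuum.NE9MarginalProjection
open Summit.QuantumFields.BalabanUV.T4Continuum.NE9MarginalProjectionEnd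

/-! ## §1 The S-binders are antitone in the class -/

section Mono

variable {C : Carriers} {Bg ι α β γ : Type}

/-- `ChannelSizeAtStepNN` is antitone in the admissible class. [folklore] -/
theorem channelSizeAtStepNN_mono {Adm Adm' : Set (Bg → C.Dom → ℝ)} (hsub : Adm' ⊆ Adm)
    {T : ℕ → (ℕ → ℝ) → (Bg → C.Dom → ℝ) → ι → ℝ} {κ : ℝ} {wt : ℕ → ι → ℝ} {τ : ℕ → ℕ → ℝ}
    (h : ChannelSizeAtStepNN Adm T κ wt τ) : ChannelSizeAtStepNN Adm' T κ wt τ :=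
  fun k j hjk s H hH hsupp N hN hbd y => h k j hjk s H (hsub hH) hsupp N hN hbd y

/-- `PieceAdditiveOn` is antitone in the class. [folklore] -/
theorem pieceAdditiveOn_mono {Adm Adm' : Set (Bg → C.Dom → ℝ)} (hsub : Adm' ⊆ Adm) {P : CPieceData C Bg ι α β γ}
    (h : PieceAdditiveOn Adm P) : PieceAdditiveOn Adm' P :=
  fun k s y a b x H₁ h₁ H₂ h₂ => h k s y a b x H₁ (hsub h₁) H₂ (hsub h₂)

/-- `ChannelAdditive` is antitone in the class. [folklore] -/
theorem channelAdditive_mono {Adm Adm' : Set (Bg → C.Dom → ℝ)} (hsub : Adm' ⊆ Adm)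
    {T : ℕ → (ℕ → ℝ) → (Bg → C.Dom → ℝ) → ι → ℝ} (h : ChannelAdditive Adm T) : ChannelAdditive Adm' T :=
  fun k s H₁ h₁ H₂ h₂ y => h k s H₁ (hsub h₁) H₂ (hsub h₂) y

end Mono

/-! ## §2 The END face at the displayed species -/

section End

variable {C₀ : Carriers} {E : Type} [NormedAddCommGroup E] [NormedSpace ℂ E] {ι α β γ δ : Type} [DecidableEq δ]

/-- **THE NE9 END (`…_compProj` face) AT THE DISPLAYED SPECIES.**  Carriers `doubleCarriers C₀`, backgrounds in the complex
configuration space `E`, channel `𝒯 := cpieceChannel D.toC` of `NE9Lemma1RemainderSpecies`, marginal-free class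
`MF ⊆ analyticClass D.R`.  DISCHARGED BY NAME: `ChannelStepSum MF 𝒯` (`channelStepSum_cpiece`), `ChannelSizeAtStepNN MF 𝒯 κ wt τ`
(`channelSizeAtStepNN_rem` — the per-piece bound PROVED on the analytic class — restricted to MF) with
`wt := weightOf D.toC.frame κ₁ d₀ O1 (KpOf D c_dir)`, `τ k j := c_Q·ω^{k−j}` and its profile (`profileG`, τ̄ = c_Q);
`ChannelAdditive MF 𝒯` from the DISPLAYED `PieceAdditiveOn (analyticClass D.R) D.toC` (crew row (w16)).  DISPLAYED, as in
the face: the projection binders, factorisation, activity two-point data, channel coupling modulus, representation, KP,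
geometry, read-out, sizes, scalars; plus the species' `RemData.Admissible` (domain inclusion (I.3.36)–(3.53), radii, G1) and
`LevelCountsG` ((1.26)–(1.28)).  Conclusion LITERALLY the face's. [cite: Balaban1988RG2Cluster, (1.23)-(1.29) pp.7-8, (1.36) p.9] -/
theorem termSize_ne9_and_fadingMemory_rem_compProj (G : ClusterGeom (doubleCarriers C₀)) {Pot : Type*}
    [NormedAddCommGroup Pot] [NormedSpace ℂ Pot] {D : RemData C₀ E ι α β γ δ} {ℓg : ℕ → ℕ → ℝ} {cdir d0 O1 cQ : ℝ}
    {Ef : Functional (doubleCarriers C₀) E} {W : Set (ℕ → ℝ)}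
    {Adm MF : Set (E → (doubleCarriers C₀).Dom → ℝ)}
    {P : (E → (doubleCarriers C₀).Dom → ℝ) → (E → (doubleCarriers C₀).Dom → ℝ)}
    {Ψ : ℕ → ℝ → (ι → ℝ) → E → (doubleCarriers C₀).Dom → ℝ} {act : ℕ → ℝ → E → Pot → G.P → ℂ} {𝒜 : ℕ → Set Pot}
    {n : ℕ → ℝ → E → G.P → ℝ} {lip clip : ℕ → ℝ} {a d : G.P → ℝ} {δv : (doubleCarriers C₀).Dom → ℝ}
    {κ B lipbar clipbar qTbar ω c : ℝ} {qT p₀ N : ℕ → ℝ}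
    -- the species' binders (printed TYPE + numerals) and the class
    (hD : D.Admissible ℓg cdir d0) (hℓg : ∀ k j, 0 ≤ ℓg k j)
    (hL : LevelCountsG D.toC.frame κ D.κ₁ O1 cQ (fun k j => ℓg k j ^ 5) (agePow ω)) (hO1 : 0 ≤ O1) (hcQ : 0 ≤ cQ)
    (hMF : MF ⊆ analyticClass D.R) (hA : PieceAdditiveOn (analyticClass D.R) D.toC)
    -- the face's binders, verbatim
    (ρ : ℕ → (ι → ℝ) → Pot) (U₀ : E) (explZ : ℕ → E → (doubleCarriers C₀).Dom → ℝ) (h0 : ScaleZeroFree Ef W)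
    (hAdm : AdmissibleTerms Ef W Adm) (hres : AdmRestrict Adm)
    (hPadd : ProjAdditive Adm P) (hPcomm : ProjScaleComm Adm P) (hPinto : ProjInto Adm MF P) (hPsize : ProjSize Adm P κ c)
    (hc : 0 ≤ c)
    (hfac : Factorises Ef W (compProj (cpieceChannel D.toC) P) Ψ) (hclip0 : ∀ k, 0 ≤ clip k)
    (hCup : ∀ g ∈ W, ∀ g' ∈ W, ∀ (k : ℕ) (U : E) (X : (doubleCarriers C₀).Dom), (doubleCarriers C₀).scale X = k + 1 →
      ∀ Q ∈ 𝒜 k, ∀ γ' ∈ G.vol X,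
      ‖act k (g k) U Q γ'‖ ≤ n k (g' k) U γ' ∧
        ‖act k (g k) U Q γ' - act k (g' k) U Q γ'‖ ≤ clip k * |g k - g' k| * n k (g' k) U γ')
    (hqT0 : ∀ k, 0 ≤ qT k)
    (hTcup : ∀ g ∈ W, ∀ g' ∈ W, ∀ (k : ℕ) (y : ι),
      |compProj (cpieceChannel D.toC) P k g (Ef g) y - compProj (cpieceChannel D.toC) P k g' (Ef g) y| ≤
        weightOf D.toC.frame D.κ₁ d0 O1 (KpOf D cdir) k y * (qT k * |g k - g' k|))
    (hreprV : ∀ (k : ℕ) (s : ℝ) (Q : ι → ℝ) (U : E) (X : (doubleCarriers C₀).Dom),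
      Ψ k s Q U X = (G.newTerm act k s U X (ρ k Q)).re - (G.newTerm act k s U₀ X (ρ k Q)).re + explZ k U X)
    (hclipb : ∀ k, clip k ≤ clipbar) (hqTb : ∀ k, qT k ≤ qTbar)
    (hK : TwoPointKP G W act 𝒜 n lip a d) (hdec : G.DecayExtract δv d) (hpin : G.PinBudget a δv (fun _ => B) κ)
    (hρ : ∀ (k : ℕ) (Q Q' : ι → ℝ) (M : ℝ),
      (∀ y, |Q y - Q' y| ≤ weightOf D.toC.frame D.κ₁ d0 O1 (KpOf D cdir) k y * M) → ‖ρ k Q - ρ k Q'‖ ≤ M)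
    (hexplZ : ∀ (k : ℕ) (U : E) (X : (doubleCarriers C₀).Dom), (doubleCarriers C₀).scale X = k + 1 →
      |explZ k U X| ≤ Real.exp (-(κ * (doubleCarriers C₀).d X)) * p₀ k)
    (hbase : ∀ g ∈ W, ∀ (U : E) (X : (doubleCarriers C₀).Dom), (doubleCarriers C₀).scale X = 0 →
      |Ef g U X| ≤ Real.exp (-(κ * (doubleCarriers C₀).d X)) * N 0)
    (hNsucc : ∀ j, p₀ j + 2 * B ≤ N (j + 1)) (hNnn : ∀ j, 0 ≤ N j)
    (hbox : ∀ (k : ℕ) (Q : ι → ℝ), (∀ y, |Q y| ≤ weightOf D.toC.frame D.κ₁ d0 O1 (KpOf D cdir) k y *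
      sizeRadius (fun k j => (1 + c) * tauOfG cQ (agePow ω) k j) N k) → ρ k Q ∈ 𝒜 k)
    (hB : 0 ≤ B) (hlipb : ∀ k, lip k ≤ lipbar) (hω : 0 ≤ ω)
    (hpos : 0 < ω + 8 * lipbar * B * ((1 + c) * cQ)) :
    TermSize Ef W κ N ∧
      NE9 Ef W κ (prodModuli (8 * clipbar * B + 8 * lipbar * B * qTbar)
        fun _ => ω + 8 * lipbar * B * ((1 + c) * cQ)) ∧
        FadingMemory ((8 * clipbar * B + 8 * lipbar * B * qTbar) / (ω + 8 * lipbar * B * ((1 + c) * cQ)))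
          (ω + 8 * lipbar * B * ((1 + c) * cQ))
          (prodModuli (8 * clipbar * B + 8 * lipbar * B * qTbar) fun _ => ω + 8 * lipbar * B * ((1 + c) * cQ)) := by
  -- the species' S-binders on MF, by name
  have hsum : ChannelStepSum MF (cpieceChannel D.toC) :=
    channelStepSum_cpiece (pieceZero_rem D) (pieceLocal_rem D) (csrcScale_rem hD) MF
  have hstep : ChannelSizeAtStepNN MF (cpieceChannel D.toC) κ (weightOf D.toC.frame D.κ₁ d0 O1 (KpOf D cdir))
      (tauOfG cQ (agePow ω)) :=
    channelSizeAtStepNN_mono hMF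
      (channelSizeAtStepNN_rem hD hℓg κ hL hO1 (fun k j => mul_nonneg hcQ (agePow_nonneg hω k j)))
  have hadd : ChannelAdditive MF (cpieceChannel D.toC) := channelAdditive_cpiece (pieceAdditiveOn_mono hMF hA)
  have hprof := profileG hcQ hω (ω := ω)
  have hτ : ∀ k j, j ≤ k → 0 ≤ tauOfG cQ (agePow ω) k j ∧ tauOfG cQ (agePow ω) k j ≤ cQ * ω ^ (k - j) :=
    fun k j hjk => ⟨mul_nonneg hcQ (agePow_nonneg hω k j), hprof.1 k j hjk⟩
  exact ne9_and_fadingMemory_of_couplingTwoPoint_vacSub_sizeInduction_compProj G ρ U₀ explZ h0 hAdm hres hPadd hPcomm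
    hPinto hPsize hc hadd hsum hstep hfac hclip0 hCup hqT0 hTcup hreprV hclipb hqTb hK hdec hpin hρ hexplZ hbase hNsucc hNnn
    hbox hB hlipb hcQ hω hpos hτ

end End

end Summit.QuantumFields.BalabanUV.T4Continuum.NE9Lemma1RemainderSpeciesEnd
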